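import Literature.Barriers.CriticalPhenomena.TimarSurgery
import HarnessLib

/-!
# "The existence of encounter points follows from insertion tolerance": a bad cluster with an
# encounter point at `o` has positive probability once three bad heavy clusters are available
# (Timár 2006, §5, Lemma 5.3 / proof of Thm. 5.5) — PROVED

Barrier catalogue `Literature/Barriers/CriticalPhenomena/`; the probabilistic half of the tripod
surgery of `TimarSurgery.lean`, a brick of the programme proving Timár's Thm. 5.5
(`Timar2006_finiteLevelUnion`, `TimarCriticalNonunimodular.lean`). The proof of Thm. 5.5 builds
a forest on the encounter points of the *bad* heavy clusters (`IsBad` = heavy and `LevelBad`,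
`TimarBadClusters.lean`), so it needs such points with positive probability; Timár: "The
existence of encounter points follows from insertion tolerance" (Lemma 5.3). By
`TimarBadClusters.lean` (`ae_badHeavyClusters_empty_or_infinite`) bad heavy clusters are almost
surely absent or infinitely many; this file proves the local-modification step:

* `exists_sphere_heavy_pruned`, `exists_tripod_surgery_isBad_isEncounter` — deterministic: three
  bad clusters meeting a ball give three sphere vertices whose tripod surgery (`TimarSurgery.lean`,
  (S2)) makes the cluster of `o` bad with an encounter point in the ball;
* **`measure_isBad_and_isEncounter_ne_zero`** — if "at least three bad heavy clusters" has positive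
  probability (`0 < p < 1`, `G` connected, locally finite, transitive), then
  `P_p(C(o) is bad and o is an encounter point of it) > 0`: localise to a ball, close the ball and
  open the tripod (deletion then insertion tolerance, `bondPercolation_real_pos_of_closeEdges` /
  `_of_openEdges`), and move the encounter point to `o` by transitivity.

## References

* Á. Timár, *Percolation on nonunimodular transitive graphs*, Ann. Probab. 34 (2006) 2344–2364
  (arXiv:math/0702875), §5: Lemma 5.3 ("follows from insertion tolerance"), Thm. 5.5 (proof,
  first paragraph). [Timar2006]
* R. Lyons, Y. Peres, *Probability on Trees and Networks*, CUP 2016, proof of Thm. 7.6 (local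
  modification). [LyonsPeres2016]
-/

noncomputable section

namespace Literature.Barriers.CriticalPhenomena

open _root_.MeasureTheory _root_.ProbabilityTheory Literature.Probability.LatticeModels
  Literature.Probability.Percolation SimpleGraph
open scoped ENNReal

variable {V : Type*}

/-! ### Deterministic preparations for the tripod surgery -/

section Det

variable {G : SimpleGraph V} [G.LocallyFinite] [DecidableEq V] {o : V} {r : ℕ}

/-- **A heavy cluster meeting the ball has a heavy pruned piece at a sphere vertex**: if `x ∈ K`
and `C(x)` is heavy then some sphere vertex `a ∈ C(x)` has a heavy `ω ∖ E_K`-cluster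
(`ω ⊆ E(G)`, `G` connected). [folklore] -/
theorem exists_sphere_heavy_pruned (hconn : G.Connected) {ω : BondConfig V} (hω : ω ⊆ G.edgeSet)
    {x : V} (hx : x ∈ ballVerts G o r) (hH : IsHeavy G o (openCluster ω x)) :
    ∃ a ∈ sphereVerts G o r, a ∈ openCluster ω x ∧
      IsHeavy G o (openCluster (prunedConfig G o r ω) a) := by
  set K := ballVerts G o r with hK
  obtain ⟨z, hzN, hz⟩ := hH.exists_isHeavy_inter hconn K.finite_toSet
    (insert x (K.biUnion fun k => G.neighborFinset k)) (fun z => openCluster (prunedConfig G o r ω) z)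
    (openCluster_subset_closeEdges_edgesAt hω x)
  obtain ⟨hzK, hheavy, -, hsub⟩ := closeEdges_edgesAt_piece hconn hω hz
  have hzx : z ∈ openCluster ω x := hsub (mem_openCluster_self _ z)
  rcases Finset.mem_insert.1 hzN with rfl | hzN
  · exact absurd hx hzK
  · obtain ⟨k, hk, hkz⟩ := Finset.mem_biUnion.1 hzN
    rw [mem_neighborFinset] at hkz
    exact ⟨z, mem_sphereVerts_of_adj hconn hk hzK hkz, hzx, hheavy⟩

/-- **(S2, deterministic)**: three bad clusters of `ω ⊆ E(G)` meeting the ball yield three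
sphere vertices whose tripod surgery makes the cluster of `o` bad with an encounter point in
the ball. [cite: Timar2006, Thm. 5.5 (proof: bad clusters) and Lemma 5.3] -/
theorem exists_tripod_surgery_isBad_isEncounter (hconn : G.Connected) {ω : BondConfig V}
    (hω : ω ⊆ G.edgeSet) {x₁ x₂ x₃ : V} (h₁ : x₁ ∈ ballVerts G o r) (h₂ : x₂ ∈ ballVerts G o r)
    (h₃ : x₃ ∈ ballVerts G o r) (hb₁ : IsBad G o ω x₁) (hb₂ : IsBad G o ω x₂) (hb₃ : IsBad G o ω x₃)
    (h₁₂ : ¬ (openGraph ω).Reachable x₁ x₂) (h₁₃ : ¬ (openGraph ω).Reachable x₁ x₃)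
    (h₂₃ : ¬ (openGraph ω).Reachable x₂ x₃) :
    ∃ a ∈ sphereVerts G o r, ∃ b ∈ sphereVerts G o r, ∃ c ∈ sphereVerts G o r,
      ∃ m ∈ ballVerts G o r, IsBad G o (surgery G o r (tripodEdges hconn o a b c) ω) m ∧
        IsEncounter G o (surgery G o r (tripodEdges hconn o a b c) ω) m := by
  obtain ⟨a, ha, hax, hHa⟩ := exists_sphere_heavy_pruned hconn hω h₁ hb₁.1
  obtain ⟨b, hb, hbx, hHb⟩ := exists_sphere_heavy_pruned hconn hω h₂ hb₂.1
  obtain ⟨c, hc, hcx, hHc⟩ := exists_sphere_heavy_pruned hconn hω h₃ hb₃.1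
  -- pruned clusters of vertices of different clusters do not meet
  have key : ∀ {x x' t t' : V}, ¬ (openGraph ω).Reachable x x' → t ∈ openCluster ω x →
      t' ∈ openCluster ω x' → t' ∉ openCluster (prunedConfig G o r ω) t := by
    intro x x' t t' hxx' ht ht' h
    have h' : t' ∈ openCluster ω t := openCluster_mono (prunedConfig_subset ω) t h
    exact hxx' ((ht.trans h').trans ht'.symm)
  have h₂₁ : ¬ (openGraph ω).Reachable x₂ x₁ := fun h => h₁₂ h.symm
  have h₃₁ : ¬ (openGraph ω).Reachable x₃ x₁ := fun h => h₁₃ h.symm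
  have h₃₂ : ¬ (openGraph ω).Reachable x₃ x₂ := fun h => h₂₃ h.symm
  have hab : a ≠ b := by
    intro h; subst h
    exact key h₁₂ hax hbx (mem_openCluster_self _ _)
  have hac : a ≠ c := by
    intro h; subst h
    exact key h₁₃ hax hcx (mem_openCluster_self _ _)
  have hbc : b ≠ c := by
    intro h; subst h
    exact key h₂₃ hbx hcx (mem_openCluster_self _ _)
  have hbadS : IsBad G o (surgery G o r (tripodEdges hconn o a b c) ω) o :=
    isBad_surgery_tripod hconn hω ha hb hc hHa fun x hx => by
      rcases hx with rfl | rfl | rfl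
      · exact (isBad_of_mem hax).2 hb₁
      · exact (isBad_of_mem hbx).2 hb₂
      · exact (isBad_of_mem hcx).2 hb₃
  have hdistinct : ∀ x y, (x = a ∨ x = b ∨ x = c) → (y = a ∨ y = b ∨ y = c) → x ≠ y →
      y ∉ openCluster (prunedConfig G o r ω) x := by
    rintro x y (rfl | rfl | rfl) (rfl | rfl | rfl) hxy
    · exact absurd rfl hxy
    · exact key h₁₂ hax hbx
    · exact key h₁₃ hax hcx
    · exact key h₂₁ hbx hax
    · exact absurd rfl hxy
    · exact key h₂₃ hbx hcx
    · exact key h₃₁ hcx hax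
    · exact key h₃₂ hcx hbx
    · exact absurd rfl hxy
  obtain ⟨m, hmK, hmo, hmE⟩ := isEncounter_surgery_tripod hconn hω ha hb hc hab hac hbc
    (fun x hx => by
      rcases hx with rfl | rfl | rfl
      exacts [hHa, hHb, hHc]) hdistinct
  exact ⟨a, ha, b, hb, c, hc, m, hmK, (isBad_of_mem hmo).2 hbadS, hmE⟩

omit [DecidableEq V] in
/-- The sphere is finite (`G` connected, locally finite). [folklore] -/
theorem sphereVerts_finite (hconn : G.Connected) (o : V) (r : ℕ) : (sphereVerts G o r).Finite :=
  (ballVerts G o (r + 1)).finite_toSet.subset fun _ hv =>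
    Finset.mem_coe.2 ((mem_ballVerts_iff hconn).2 (le_of_eq hv))

end Det

/-! ### A bad cluster with an encounter point at `o` -/

section Prob

variable {G : SimpleGraph V} [G.LocallyFinite]

/-- **(S2) If "at least three bad clusters" has positive probability, then with positive
probability `C(o)` is bad and `o` is an encounter point of it** (`G` connected, locally finite,
transitive, `0 < p < 1`): on a ball meeting three bad clusters, closing the ball and opening
the tripod to three heavy outside pieces of them (deletion then insertion tolerance) produces
with positive probability a bad cluster with an encounter point `m` in the ball; transitivity
moves `m` to `o`. [cite: Timar2006, Lemma 5.3 ("the existence of encounter points follows from insertion tolerance") and Thm. 5.5 (proof)] -/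
theorem measure_isBad_and_isEncounter_ne_zero (hconn : G.Connected) (ht : IsGraphTransitive G)
    {p : unitInterval} (hp0 : 0 < (p : ℝ)) (hp1 : (p : ℝ) < 1) (o : V)
    (h3 : bondPercolation G p {ω | (3 : ℕ∞) ≤ (badHeavyClusters G o ω).encard} ≠ 0) :
    bondPercolation G p {ω | IsBad G o ω o ∧ IsEncounter G o ω o} ≠ 0 := by
  classical
  haveI : Countable V := countable_of_connected_of_locallyFinite G hconn o
  set μ := bondPercolation G p with hμ
  -- localisation to a ball
  set E : ℕ → Set (BondConfig V) := fun r => {ω | ∃ s : Finset V, s ⊆ ballVerts G o r ∧ s.card = 3 ∧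
      (∀ x ∈ s, IsBad G o ω x) ∧ (↑s : Set V).Pairwise fun x y => ¬ (openGraph ω).Reachable x y}
    with hE
  have hcovE : {ω : BondConfig V | (3 : ℕ∞) ≤ (badHeavyClusters G o ω).encard} ⊆ ⋃ r, E r := by
    intro ω hω
    obtain ⟨s, hcard, hbad, hpair⟩ := (le_encard_badHeavyClusters_iff G o ω 3).1 hω
    exact Set.mem_iUnion.2 ⟨s.sup (G.dist o), s,
      fun x hx => (mem_ballVerts_iff hconn).2 (Finset.le_sup (f := G.dist o) hx), hcard,
      fun x hx => ⟨(hbad x hx).1, (hbad x hx).2⟩, hpair⟩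
  obtain ⟨r, hr⟩ : ∃ r, μ (E r) ≠ 0 := by
    by_contra hno
    push Not at hno
    exact h3 (measure_mono_null hcovE (measure_iUnion_null hno))
  -- the target events
  set B : V → Set (BondConfig V) := fun m => {ω | IsBad G o ω m ∧ IsEncounter G o ω m} with hB
  have hBm : ∀ m, MeasurableSet (B m) := fun m =>
    (measurableSet_isBad G o m).inter (measurableSet_isEncounter G o m)
  set Bball : Set (BondConfig V) := ⋃ m ∈ (↑(ballVerts G o r) : Set V), B m with hBball
  have hBballm : MeasurableSet Bball :=
    (ballVerts G o r).finite_toSet.measurableSet_biUnion fun m _ => hBm m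
  have hSfin : (sphereVerts G o r).Finite := sphereVerts_finite hconn o r
  set Sph := hSfin.toFinset with hSph
  set Tr : Finset (V × V × V) := Sph ×ˢ (Sph ×ˢ Sph) with hTr
  have hcov : E r ∩ {ω | ω ⊆ G.edgeSet} ⊆
      ⋃ t ∈ (↑Tr : Set (V × V × V)),
        {ω | surgery G o r (tripodEdges hconn o t.1 t.2.1 t.2.2) ω ∈ Bball} := by
    rintro ω ⟨⟨s, hs, hcard, hbad, hpair⟩, hωE⟩
    obtain ⟨x₁, x₂, x₃, h12, h13, h23, rfl⟩ := Finset.card_eq_three.1 hcard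
    have hx₁ : x₁ ∈ ({x₁, x₂, x₃} : Finset V) := by simp
    have hx₂ : x₂ ∈ ({x₁, x₂, x₃} : Finset V) := by simp
    have hx₃ : x₃ ∈ ({x₁, x₂, x₃} : Finset V) := by simp
    obtain ⟨a, ha, b, hb, c, hc, m, hm, hbadm, hEm⟩ :=
      exists_tripod_surgery_isBad_isEncounter hconn hωE (hs hx₁) (hs hx₂) (hs hx₃) (hbad _ hx₁)
        (hbad _ hx₂) (hbad _ hx₃) (hpair (Finset.mem_coe.2 hx₁) (Finset.mem_coe.2 hx₂) h12)
        (hpair (Finset.mem_coe.2 hx₁) (Finset.mem_coe.2 hx₃) h13)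
        (hpair (Finset.mem_coe.2 hx₂) (Finset.mem_coe.2 hx₃) h23)
    have ht3 : ((a, b, c) : V × V × V) ∈ Tr := by
      simp only [hTr, Finset.mem_product, hSph, Set.Finite.mem_toFinset]
      exact ⟨ha, hb, hc⟩
    exact Set.mem_biUnion (Finset.mem_coe.2 ht3) (Set.mem_biUnion (Finset.mem_coe.2 hm) ⟨hbadm, hEm⟩)
  have hpos : μ (⋃ t ∈ (↑Tr : Set (V × V × V)),
      {ω | surgery G o r (tripodEdges hconn o t.1 t.2.1 t.2.2) ω ∈ Bball}) ≠ 0 :=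
    fun h0 => measure_inter_ne_zero_of_ae hr setBernoulli_ae_subset (measure_mono_null hcov h0)
  rw [Ne, measure_biUnion_null_iff Tr.countable_toSet, not_forall] at hpos
  obtain ⟨t, ht'⟩ := hpos
  rw [Classical.not_imp] at ht'
  obtain ⟨-, htpos⟩ := ht'
  -- deletion tolerance, then insertion tolerance
  set T := tripodEdges hconn o t.1 t.2.1 t.2.2 with hTdef
  have hTfin : T.Finite :=
    ((chainEdges_finite hconn _).union (chainEdges_finite hconn _)).union (chainEdges_finite hconn _)
  have hTE : T ⊆ G.edgeSet := tripodEdges_subset_edgeSet hconn o _ _ _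
  have h1 : 0 < μ.real (openEdges T ⁻¹' Bball) :=
    bondPercolation_real_pos_of_closeEdges G hp1 (ballEdges G o r) ((measurable_openEdges _) hBballm)
      (ENNReal.toReal_pos htpos (measure_ne_top _ _)) fun ω hω => hω
  have h2 : 0 < μ.real Bball :=
    bondPercolation_real_pos_of_openEdges G hp0 hTfin.toFinset (by rwa [Set.Finite.coe_toFinset])
      hBballm h1 fun ω hω => by rwa [Set.Finite.coe_toFinset]
  have h3' : μ Bball ≠ 0 := by
    intro h0
    rw [measureReal_def, h0, ENNReal.toReal_zero] at h2
    exact lt_irrefl _ h2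
  rw [hBball, Ne, measure_biUnion_null_iff (ballVerts G o r).countable_toSet, not_forall] at h3'
  obtain ⟨m, hm'⟩ := h3'
  rw [Classical.not_imp] at hm'
  obtain ⟨-, hm⟩ := hm'
  -- transport `m ↦ o` by an automorphism
  obtain ⟨γ, hγ⟩ := ht m o
  have hpre : BondConfig.relabel (sym2Equiv γ.toEquiv) ⁻¹' (B o) = B m := by
    ext ω
    have h1' := isBad_relabel_iff G hconn γ o ω m
    have h2' := isEncounter_relabel_iff G hconn γ o ω m
    rw [hγ] at h1' h2'
    simp only [Set.mem_preimage, hB, Set.mem_setOf_eq]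
    exact and_congr h1' h2'
  have hmo : μ (B m) = μ (B o) := by
    rw [← hpre, ← Measure.map_apply (BondConfig.relabel _).measurable (hBm o), hμ,
      bondPercolation_map_relabel_iso γ p]
  rwa [hmo] at hm

end Prob

end Literature.Barriers.CriticalPhenomena

end
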